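import Mathlib.Analysis.Calculus.ContDiff.Operations
import Mathlib.Analysis.SpecialFunctions.Exponential
import Literature.MathematicalPhysics.QuantumFieldTheory.Balaban1983to89.BlockAveragingEMLAnalyticMean
import Literature.MathematicalPhysics.QuantumFieldTheory.Balaban1983to89.Node00.CriticalOnFibreTangent

/-!
# NODE 00 — THE AVERAGING OF RECORD IS SMOOTH AT SMALL FIELDS: its matrix extension (walk products with adjoints, the UNGUARDED `exp[mean log]`), agreement
# with `BlockAveraging.avgFun expMeanLogSU` on the small-field guard, `C^∞` there, and the same for the `k`-fold iterate `Ū^k` (module 35b-i of GAP-STATED(submersion))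

Cell `pub-ymgap`, seat `pub-ymgap-dag-n07-e` generation 14 (R141 (C), DAG node N07 = [15] = [Balaban1985Variational]; MODULE 35b-i, INBOX INTENT-35b).  NEW leaf;
CONSUMED BY NAME, nothing modified: the tree's `BlockAveraging` ([I] (0.3)–(0.4): `Idx`, `off`, `loopHol`, `Small`, `corr`, `avgFun`, `blockAvg`, `axialAvg_eq_holAt_walk`),
`T4Continuum.walk`∕`holAt`, `ExpMeanLog` (`eml`, `expMeanLogSU`, `deltaSU`, `analyticAt_eml`), `BlockAveragingEMLAnalyticMean.coe_expMeanLogSU_E_eq_eml`, and this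
seat's `Node00.CriticalOnFibreTangent` (`expChart`).  `--kind definition --supports stmt-QuantumFields-20541` (K0⁷).

WHY.  Module 35a reduced «curve-critical ⇒ tangent-critical (82)» to a SUBMERSIVE CHART of the constraint `Ū^j = W_j` (`IsFibreChartNear`); the canonical chart is
`X ↦ log(W⁻¹·Ū^k(U·exp X))` and its first requirement is STRICT DIFFERENTIABILITY — i.e. that the averaging of record `U ↦ Ū` ([I] (0.4): `Ū(c) = exp[|I|⁻¹ Σ_i
log U(loop_i)]·U([c₋,c₊])`, the tree's `BlockAveraging.avgFun expMeanLogSU` = `Node00.avOfRecord`) is `C¹` near small-field configurations; the chart-free road of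
35c (fibre curves from the route `UnitScaleTilt`'s exact corrector) needs the same smoothness for the continuity of the iterated averages along a ray.  The tree's `avgFun`
is a map of `SU(N)`-valued fields with a GUARD (`corr = 1` off the small-field domain); this file writes its MATRIX EXTENSION — products of bond matrices and their
adjoints along the (0.4) walks, then the UNGUARDED analytic `eml` (`ExpMeanLog.analyticAt_eml`, [I] p. 253 «we assume that it is an analytic function») —, proves
that on `SU(N)`-valued fields inside the guard the extension IS the averaging of record, and that it is `C^∞` (real) there; likewise for the iterate `Ū^k` under the
guard at every level `< k`, and for the composition with 35a's exponential chart `X ↦ U·exp X`.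

CONTENTS (`M = M_N(ℂ)`, fields `V : bonds → M`; level `j`, torus `P`).
* §1 `coeField U = (b ↦ ↑(U b))`; `stepM`, ★ `holM V γ = ∏_{s∈γ} V(s)^{(⋆)}` (adjoint on backward steps); `coe_holAt` (`↑(holAt U γ) = holM ↑U γ`: `↑(g⁻¹) = (↑g)⋆` in
  `SU(N)`); `contDiff_stepM`, ★ `contDiff_holM` (polynomial in the entries and their conjugates: `C^∞`).
* §2 `loopM`, `axialM`, ★ `corrM V c = eml{holM V loop_i}` (NO guard), ★ `avgM V c = corrM V c · axialM V c`; `coe_loopHol`, `coe_axialAvg`, `eml_comp_equiv`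
  (reindexing the uniform mean), ★ `coe_corr_of_small`, ★★ `coe_avgFun_of_small` — ON THE GUARD `Small expMeanLogSU U c` the matrix of `Ū(c)` IS `avgM ↑U c`;
  `norm_loopM_coeField_sub_one_lt_one` (guard ⇒ polydisc), ★ `contDiffAt_corrM`, ★★ `contDiffAt_avgM` (`C^∞` at every field whose (0.4) loop matrices lie in the
  polydisc `‖W − 1‖ < 1`, in particular at `↑U` for `U` in the guard at every coarse bond).
* §3 ★ `iterM k` (the iterate of `avgM` from level `0` to level `k`), `SmallBelow av k U` (the guard at every level `< k` along `Ū^•`), ★★ `coeField_iter_eq_iterM`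
  (`↑(Ū^k) = iterM k ↑U` under `SmallBelow`), ★★ `contDiffAt_iterM`; at NODE 00's objects: `coeField_avgFamily_eq_iterM`, `contDiffAt_iterM_avOfRecord`.
* §4 the chart end: `contDiff_coeField_expChart` (`X ↦ ↑(U·exp X)` is `C^∞`, `NormedSpace.exp_analytic`), ★★ `contDiffAt_iterM_expChart`
  (`X ↦ iterM k ↑(U·exp X)` is `C^∞` at `0` under `SmallBelow … k U`) — what 35c uses for the continuity of the iterated averages along the ray `U·exp(tX)`,
  and the differentiability half of 35a's `IsFibreChartNear` for any logarithmic canonical chart.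

HONEST FRAMING: calculus about the tree's own averaging map (products, adjoints, the analytic `exp[mean log]`); definitions with bodies (the matrix extension) and
kernel lemmas; NO estimate of [15]∕[6]∕[I]; the surjectivity half of the submersion (35c) NOT here; V16 stub 1 ∕ K0⁷ NOT closed; N07 NOT discharged; counts unmoved
(5∕27); one finite T⁴ programme at fixed ε — NOT continuum ∕ ℝ⁴ ∕ OS ∕ mass gap ∕ Clay.  No `sorry`, no `instance`, no `notation`.
-/

noncomputable section

namespace Literature.MathematicalPhysics.QuantumFieldTheory.Balaban1983to89.Node00

open Filter Topology
open T4Continuum BlockAveraging B15DeterminingSets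
open ExpMeanLog (eml eml_eq_exp expMeanLogSU deltaSU analyticAt_eml lt_third_of_lt_deltaSU)
open T4AdjointCovarianceUnitary (lieSU expSU coe_expSU)
open scoped Matrix.Norms.L2Operator

/-! ## §1  Bond matrices, step matrices, walk products -/

section Walks

variable {P : Params} {j : ℕ} {N : ℕ}

/-- The field of bond MATRICES of an `SU(N)` configuration. [cite: Balaban1987RG1, (0.1) p.251 (bookkeeping)] -/
def coeField (U : GaugeField P j (SU N)) : PBond P j → Matrix (Fin N) (Fin N) ℂ := fun b => (U b : Matrix (Fin N) (Fin N) ℂ)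

/-- Unfolding of `coeField`. [cite: Balaban1987RG1, (0.1) p.251 (bookkeeping)] -/
@[simp] theorem coeField_apply (U : GaugeField P j (SU N)) (b : PBond P j) : coeField U b = (U b : Matrix (Fin N) (Fin N) ℂ) := rfl

/-- The matrix of one oriented step: `V(b)` forward, `V(b)⋆` backward. [cite: ChatterjeeYMProb2019, §2 (bookkeeping)] -/
def stepM (V : PBond P j → Matrix (Fin N) (Fin N) ℂ) (s : LStep P j) : Matrix (Fin N) (Fin N) ℂ :=
  if s.fwd then V s.bond else star (V s.bond)

/-- ★ **THE WALK PRODUCT OF BOND MATRICES** (the matrix extension of the tree's holonomy `T4Continuum.holAt`): the ordered product of the step matrices.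
[cite: ChatterjeeYMProb2019, §2 (bookkeeping); Balaban1987RG1, (0.4) p.253] -/
def holM (V : PBond P j → Matrix (Fin N) (Fin N) ℂ) (γ : List (LStep P j)) : Matrix (Fin N) (Fin N) ℂ := (γ.map (stepM V)).prod

/-- `holM V [] = 1`. [cite: ChatterjeeYMProb2019, §2 (bookkeeping)] -/
@[simp] theorem holM_nil (V : PBond P j → Matrix (Fin N) (Fin N) ℂ) : holM V [] = 1 := by simp [holM]

/-- `holM V (s :: γ) = stepM V s · holM V γ`. [cite: ChatterjeeYMProb2019, §2 (bookkeeping)] -/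
theorem holM_cons (V : PBond P j → Matrix (Fin N) (Fin N) ℂ) (s : LStep P j) (γ : List (LStep P j)) :
    holM V (s :: γ) = stepM V s * holM V γ := by
  simp [holM]

/-- Evaluation at a bond is `C^∞` (a continuous linear map). [cite: Balaban1987RG1, p.253 («analytic function»; bookkeeping)] -/
theorem contDiff_eval (b : PBond P j) : ContDiff ℝ ⊤ (fun V : PBond P j → Matrix (Fin N) (Fin N) ℂ => V b) :=
  contDiff_apply ℝ (Matrix (Fin N) (Fin N) ℂ) b

/-- A step matrix is a `C^∞` function of the field (evaluation, possibly followed by the real-linear adjoint). [cite: Balaban1987RG1, p.253 («analytic function»; bookkeeping)] -/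
theorem contDiff_stepM (s : LStep P j) : ContDiff ℝ ⊤ (fun V : PBond P j → Matrix (Fin N) (Fin N) ℂ => stepM V s) := by
  unfold stepM
  by_cases h : s.fwd
  · simp only [h, if_true]
    exact contDiff_eval s.bond
  · simp only [h]
    exact (starL' ℝ : Matrix (Fin N) (Fin N) ℂ ≃L[ℝ] Matrix (Fin N) (Fin N) ℂ).contDiff.comp (contDiff_eval s.bond)

/-- ★ **WALK PRODUCTS ARE `C^∞`** (finite products of `C^∞` maps into the Banach algebra `M_N(ℂ)`). [cite: Balaban1987RG1, p.253 («analytic function»; bookkeeping)] -/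
theorem contDiff_holM : ∀ γ : List (LStep P j), ContDiff ℝ ⊤ (fun V : PBond P j → Matrix (Fin N) (Fin N) ℂ => holM V γ)
  | [] => by
    simp only [holM_nil]
    exact contDiff_const
  | s :: γ => by
    simp only [holM_cons]
    exact (contDiff_stepM s).mul (contDiff_holM γ)

end Walks

section WalksSU

variable {P : Params} {j : ℕ} {N : ℕ} [NeZero N]

omit [NeZero N] in
/-- On an `SU(N)` field the step matrix is the matrix of the tree's step factor `U(b)^{±1}` (`↑(g⁻¹) = (↑g)⋆`). [cite: ChatterjeeYMProb2019, §2 (bookkeeping)] -/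
theorem coe_step (U : GaugeField P j (SU N)) (s : LStep P j) :
    (((if s.fwd then U s.bond else (U s.bond)⁻¹ : SU N)) : Matrix (Fin N) (Fin N) ℂ) = stepM (coeField U) s := by
  unfold stepM
  split_ifs <;> rfl

/-- ★ **THE MATRIX OF A HOLONOMY IS THE WALK PRODUCT OF THE BOND MATRICES**: `↑(holAt U γ) = holM ↑U γ`. [cite: ChatterjeeYMProb2019, §2 (bookkeeping); Balaban1987RG1, (0.4) p.253] -/
theorem coe_holAt (U : GaugeField P j (SU N)) : ∀ γ : List (LStep P j),
    ((holAt U γ : SU N) : Matrix (Fin N) (Fin N) ℂ) = holM (coeField U) γ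
  | [] => by rw [holAt_nil, holM_nil]; rfl
  | s :: γ => by
    rw [holAt_cons, holM_cons, Submonoid.coe_mul, coe_holAt U γ, coe_step]

end WalksSU

/-! ## §2  The one-step averaging (0.4) as a matrix map: loops, the straight segment, the UNGUARDED `exp[mean log]`, agreement on the guard, smoothness -/

section OneStep

variable {P : Params} {j : ℕ} {N : ℕ}

/-- The (0.4) loop matrices `V(Γ ∪ [x,x′] ∪ (−Γ′) ∪ (−c))` (matrix extension of `BlockAveraging.loopHol`). [cite: Balaban1987RG1, (0.4) p.253] -/
def loopM (V : PBond P j → Matrix (Fin N) (Fin N) ℂ) (c : PBond P (j + 1)) (i : Idx P) : Matrix (Fin N) (Fin N) ℂ :=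
  holM V (walk (emb c.src) (loopWord P.L c.dir (off i.1) i.2.1 i.2.2))

/-- The straight-segment matrix `V([c₋, c₊])` (matrix extension of `AveragingRT.axialAvg`, via `axialAvg_eq_holAt_walk`). [cite: Balaban1987RG1, (0.4) p.253] -/
def axialM (V : PBond P j → Matrix (Fin N) (Fin N) ℂ) (c : PBond P (j + 1)) : Matrix (Fin N) (Fin N) ℂ :=
  holM V (walk (emb c.src) (List.replicate P.L (c.dir, true)))

/-- ★ The UNGUARDED correction factor `exp[|I|⁻¹ Σ_i log V(loop_i)]` — the tree's analytic `ExpMeanLog.eml` of the loop matrices, with NO small-field guard (the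
smooth extension of `BlockAveraging.corr expMeanLogSU`, which is `1` off the guard). [cite: Balaban1987RG1, (0.4) p.253] -/
def corrM (V : PBond P j → Matrix (Fin N) (Fin N) ℂ) (c : PBond P (j + 1)) : Matrix (Fin N) (Fin N) ℂ :=
  eml fun i : Idx P => loopM V c i

/-- ★ **THE MATRIX EXTENSION OF THE AVERAGING OF RECORD (0.4)**: `avgM V c = exp[|I|⁻¹ Σ_i log V(loop_i)] · V([c₋, c₊])`. [cite: Balaban1987RG1, (0.4) p.253] -/
def avgM (V : PBond P j → Matrix (Fin N) (Fin N) ℂ) : PBond P (j + 1) → Matrix (Fin N) (Fin N) ℂ := fun c => corrM V c * axialM V c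

/-- **REINDEXING THE UNIFORM MEAN**: `eml (W ∘ e) = eml W` for an equivalence `e : κ ≃ ι` of finite index types. [cite: Balaban1987RG1, (0.7) p.253 (bookkeeping)] -/
theorem eml_comp_equiv {ι κ : Type*} [Fintype ι] [Fintype κ] (W : ι → Matrix (Fin N) (Fin N) ℂ) (e : κ ≃ ι) :
    eml (W ∘ e) = eml W := by
  rw [eml_eq_exp, eml_eq_exp, Fintype.card_congr e]
  congr 2
  exact e.sum_comp (fun i => MatrixLog.mlog (W i))

/-- The loop matrices are `C^∞` in the field. [cite: Balaban1987RG1, p.253 («analytic function»; bookkeeping)] -/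
theorem contDiff_loopM (c : PBond P (j + 1)) (i : Idx P) : ContDiff ℝ ⊤ (fun V : PBond P j → Matrix (Fin N) (Fin N) ℂ => loopM V c i) :=
  contDiff_holM _

/-- The straight-segment matrix is `C^∞` in the field. [cite: Balaban1987RG1, p.253 («analytic function»; bookkeeping)] -/
theorem contDiff_axialM (c : PBond P (j + 1)) : ContDiff ℝ ⊤ (fun V : PBond P j → Matrix (Fin N) (Fin N) ℂ => axialM V c) :=
  contDiff_holM _

/-- ★ **THE UNGUARDED CORRECTION FACTOR IS `C^∞` AT EVERY FIELD WHOSE LOOP MATRICES LIE IN THE POLYDISC `‖W − 1‖ < 1`** (composition of the `C^∞` loop matrices with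
the complex-analytic `eml`, `ExpMeanLog.analyticAt_eml`, read over `ℝ`). [cite: Balaban1987RG1, p.253 («we assume that it is an analytic function»)] -/
theorem contDiffAt_corrM {V₀ : PBond P j → Matrix (Fin N) (Fin N) ℂ} (c : PBond P (j + 1)) (h : ∀ i, ‖loopM V₀ c i - 1‖ < 1) :
    ContDiffAt ℝ ⊤ (fun V : PBond P j → Matrix (Fin N) (Fin N) ℂ => corrM V c) V₀ := by
  have hin : ContDiff ℝ ⊤ (fun V : PBond P j → Matrix (Fin N) (Fin N) ℂ => fun i : Idx P => loopM V c i) :=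
    contDiff_pi.2 fun i => contDiff_loopM c i
  have heml : ContDiffAt ℝ ⊤ (eml : (Idx P → Matrix (Fin N) (Fin N) ℂ) → Matrix (Fin N) (Fin N) ℂ) (fun i => loopM V₀ c i) :=
    ((analyticAt_eml (𝔸 := Matrix (Fin N) (Fin N) ℂ) h).contDiffAt).restrict_scalars ℝ
  exact heml.comp V₀ hin.contDiffAt

/-- ★★ **THE MATRIX EXTENSION OF THE AVERAGING IS `C^∞` AT EVERY FIELD WHOSE (0.4) LOOP MATRICES LIE IN THE POLYDISC** (at every coarse bond). [cite: Balaban1987RG1, (0.4) p.253, p.253 («analytic function»)] -/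
theorem contDiffAt_avgM {V₀ : PBond P j → Matrix (Fin N) (Fin N) ℂ} (h : ∀ (c : PBond P (j + 1)) (i : Idx P), ‖loopM V₀ c i - 1‖ < 1) :
    ContDiffAt ℝ ⊤ (avgM : (PBond P j → Matrix (Fin N) (Fin N) ℂ) → PBond P (j + 1) → Matrix (Fin N) (Fin N) ℂ) V₀ :=
  contDiffAt_pi.2 fun c => (contDiffAt_corrM c (h c)).mul (contDiff_axialM c).contDiffAt

end OneStep

section OneStepSU

variable {P : Params} {j : ℕ} {N : ℕ} [NeZero N]

/-- `↑(loopHol U c i) = loopM ↑U c i`. [cite: Balaban1987RG1, (0.4) p.253 (bookkeeping)] -/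
theorem coe_loopHol (U : GaugeField P j (SU N)) (c : PBond P (j + 1)) (i : Idx P) :
    ((loopHol U c i : SU N) : Matrix (Fin N) (Fin N) ℂ) = loopM (coeField U) c i :=
  coe_holAt U _

/-- `↑(axialAvg U c) = axialM ↑U c`. [cite: Balaban1987RG1, (0.4) p.253 (bookkeeping)] -/
theorem coe_axialAvg (U : GaugeField P j (SU N)) (c : PBond P (j + 1)) :
    ((AveragingRT.axialAvg U c : SU N) : Matrix (Fin N) (Fin N) ℂ) = axialM (coeField U) c := by
  rw [axialAvg_eq_holAt_walk]
  exact coe_holAt U _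

/-- In the model `dist1 g = ‖↑g − 1‖` (definitional), so the guard reads on the loop MATRICES. [cite: Balaban1985Averaging, (19) p.21 (bookkeeping)] -/
theorem norm_loopM_coeField_sub_one_lt (U : GaugeField P j (SU N)) (c : PBond P (j + 1)) (h : Small expMeanLogSU U c)
    (i : Idx P) : ‖loopM (coeField U) c i - 1‖ < deltaSU (Fin N) := by
  rw [← coe_loopHol]
  exact h i

/-- On the guard every loop matrix lies in the polydisc `‖W − 1‖ < 1` of the analytic `eml` ∕ `log` (`δ_N ≤ 1/3 < 1`). [cite: Balaban1987RG1, (0.4) p.253 (bookkeeping)] -/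
theorem norm_loopM_coeField_sub_one_lt_one (U : GaugeField P j (SU N)) (c : PBond P (j + 1)) (h : Small expMeanLogSU U c)
    (i : Idx P) : ‖loopM (coeField U) c i - 1‖ < 1 :=
  (lt_third_of_lt_deltaSU (norm_loopM_coeField_sub_one_lt U c h i)).trans (by norm_num)

/-- ★ **ON THE GUARD THE CORRECTION FACTOR IS THE UNGUARDED `eml` OF THE LOOP MATRICES**: `↑(corr expMeanLogSU U c) = corrM ↑U c` when `Small expMeanLogSU U c`.
[cite: Balaban1987RG1, (0.4) p.253] -/
theorem coe_corr_of_small (U : GaugeField P j (SU N)) (c : PBond P (j + 1)) (h : Small expMeanLogSU U c) :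
    ((corr expMeanLogSU U c : SU N) : Matrix (Fin N) (Fin N) ℂ) = corrM (coeField U) c := by
  haveI : Nonempty (Fin N) := ⟨⟨0, Nat.pos_of_ne_zero (NeZero.ne N)⟩⟩
  unfold corr
  rw [if_pos h]
  show (((expMeanLogSU (n := Fin N)).E (loopHol U c ∘ (LoopAverage.enum (Idx P)).symm) : SU N) : Matrix (Fin N) (Fin N) ℂ) = _
  have hsmall : ∀ k, dist1 ((loopHol U c ∘ (LoopAverage.enum (Idx P)).symm) k) < deltaSU (Fin N) := fun k => h _
  rw [BlockAveragingEMLAnalyticMean.coe_expMeanLogSU_E_eq_eml _ hsmall]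
  have hfun : (fun k => (((loopHol U c ∘ (LoopAverage.enum (Idx P)).symm) k : SU N) : Matrix (Fin N) (Fin N) ℂ)) =
      (fun i => loopM (coeField U) c i) ∘ (LoopAverage.enum (Idx P)).symm := by
    funext k
    simp only [Function.comp_apply, coe_loopHol]
  rw [hfun, eml_comp_equiv]
  rfl

/-- ★★ **ON THE GUARD THE MATRIX OF `Ū(c)` IS `avgM ↑U c`** — the matrix extension agrees with the averaging of record `BlockAveraging.avgFun expMeanLogSU`
(= `Node00.avOfRecord`) at every small-field configuration. [cite: Balaban1987RG1, (0.4) p.253] -/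
theorem coe_avgFun_of_small (U : GaugeField P j (SU N)) (c : PBond P (j + 1)) (h : Small expMeanLogSU U c) :
    ((avgFun expMeanLogSU U c : SU N) : Matrix (Fin N) (Fin N) ℂ) = avgM (coeField U) c := by
  unfold avgFun avgM
  rw [Submonoid.coe_mul, coe_corr_of_small U c h, coe_axialAvg]

/-- The polydisc hypothesis at `↑U` from the guard at every coarse bond. [cite: Balaban1987RG1, (0.4) p.253 (bookkeeping)] -/
theorem contDiffAt_avgM_coeField {U : GaugeField P j (SU N)} (h : ∀ c : PBond P (j + 1), Small expMeanLogSU U c) :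
    ContDiffAt ℝ ⊤ (avgM : (PBond P j → Matrix (Fin N) (Fin N) ℂ) → PBond P (j + 1) → Matrix (Fin N) (Fin N) ℂ) (coeField U) :=
  contDiffAt_avgM fun c i => norm_loopM_coeField_sub_one_lt_one U c (h c) i

end OneStepSU

/-! ## §3  The `k`-fold iterate `Ū^k` as a matrix map -/

section Iterate

variable {P : Params} {N : ℕ}

/-- ★ **THE ITERATED MATRIX AVERAGING** from level `0` to level `k` (the matrix extension of `Setup.Averaging.iter`). [cite: Balaban1987RG1, (0.11)/(0.21) pp.253–256] -/
def iterM : (k : ℕ) → (PBond P 0 → Matrix (Fin N) (Fin N) ℂ) → (PBond P k → Matrix (Fin N) (Fin N) ℂ)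
  | 0 => id
  | k + 1 => fun V => avgM (iterM k V)

/-- `iterM 0 = id`. [cite: Balaban1987RG1, (0.21) p.256 (bookkeeping)] -/
@[simp] theorem iterM_zero (V : PBond P 0 → Matrix (Fin N) (Fin N) ℂ) : iterM 0 V = V := rfl

/-- `iterM (k+1) V = avgM (iterM k V)`. [cite: Balaban1987RG1, (0.21) p.256 (bookkeeping)] -/
theorem iterM_succ (k : ℕ) (V : PBond P 0 → Matrix (Fin N) (Fin N) ℂ) : iterM (k + 1) V = avgM (iterM k V) := rfl

variable [NeZero N]

/-- **THE GUARD ALONG THE ITERATES**: the small-field condition of (0.4) at every coarse bond of every level `< k`, for the successive averages `Ū^j` of `U`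
under the family `av`. [cite: Balaban1987RG1, (0.4) p.253, (0.21) p.256] -/
def SmallBelow (av : ∀ j, Averaging P j (SU N)) (k : ℕ) (U : GaugeField P 0 (SU N)) : Prop :=
  ∀ j, j < k → ∀ c : PBond P (j + 1), Small expMeanLogSU (Averaging.iter av j U) c

/-- `SmallBelow` is monotone in the level. [cite: Balaban1987RG1, (0.21) p.256 (bookkeeping)] -/
theorem SmallBelow.mono {av : ∀ j, Averaging P j (SU N)} {k k' : ℕ} {U : GaugeField P 0 (SU N)} (h : SmallBelow av k U) (hk : k' ≤ k) :
    SmallBelow av k' U :=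
  fun j hj c => h j (lt_of_lt_of_le hj hk) c

/-- ★★ **UNDER THE GUARD AT EVERY LEVEL `< k`, THE MATRIX OF `Ū^k` IS `iterM k ↑U`** (for the family of (0.4) block averagings with the printed `exp[mean log]`).
[cite: Balaban1987RG1, (0.4) p.253, (0.21) p.256] -/
theorem coeField_iter_eq_iterM {U : GaugeField P 0 (SU N)} :
    ∀ k, SmallBelow (fun j => blockAvg (P := P) (j := j) expMeanLogSU) k U →
      coeField (Averaging.iter (fun j => blockAvg (P := P) (j := j) expMeanLogSU) k U) = iterM k (coeField U)
  | 0, _ => rfl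
  | k + 1, h => by
    have ih := coeField_iter_eq_iterM k (h.mono (Nat.le_succ k))
    rw [iterM_succ, ← ih]
    funext c
    show (((blockAvg expMeanLogSU).avg (Averaging.iter (fun j => blockAvg (P := P) (j := j) expMeanLogSU) k U) c : SU N) :
        Matrix (Fin N) (Fin N) ℂ) = _
    rw [BlockAveraging.blockAvg_avg]
    exact coe_avgFun_of_small _ c (h k (Nat.lt_succ_self k) c)

/-- ★★ **THE ITERATE IS `C^∞` AT `↑U` UNDER THE GUARD AT EVERY LEVEL `< k`** (induction: `avgM` is `C^∞` at `iterM j ↑U = ↑(Ū^j)`, whose loop matrices are in the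
polydisc by the guard at level `j`). [cite: Balaban1987RG1, (0.4) p.253 («analytic function»), (0.21) p.256] -/
theorem contDiffAt_iterM {U : GaugeField P 0 (SU N)} :
    ∀ k, SmallBelow (fun j => blockAvg (P := P) (j := j) expMeanLogSU) k U →
      ContDiffAt ℝ ⊤ (iterM k : (PBond P 0 → Matrix (Fin N) (Fin N) ℂ) → PBond P k → Matrix (Fin N) (Fin N) ℂ) (coeField U)
  | 0, _ => contDiffAt_id
  | k + 1, h => by
    have ih := contDiffAt_iterM k (h.mono (Nat.le_succ k))
    have hk : ContDiffAt ℝ ⊤ (avgM : (PBond P k → Matrix (Fin N) (Fin N) ℂ) → PBond P (k + 1) → Matrix (Fin N) (Fin N) ℂ)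
        (iterM k (coeField U)) := by
      rw [← coeField_iter_eq_iterM k (h.mono (Nat.le_succ k))]
      exact contDiffAt_avgM_coeField fun c => h k (Nat.lt_succ_self k) c
    exact hk.comp (coeField U) ih

end Iterate

/-! ### At NODE 00's objects (`avOfRecord F N K j = blockAvg expMeanLogSU`, `rfl`) -/

section Record

variable {F : T4Family} {N : ℕ} [NeZero N]

/-- At the objects of record: under the guard below `k`, `↑(Ū^k) = iterM k ↑U` for `avgFamily (avOfRecord F N K)`. [cite: Balaban1987RG1, (0.4) p.253, (0.21) p.256; Balaban1988Convergent, (2.11) p.256] -/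
theorem coeField_avgFamily_eq_iterM {K k : ℕ} {U : GaugeField (F.P K) 0 (SU N)} (h : SmallBelow (avOfRecord F N K) k U) :
    coeField (avgFamily (avOfRecord F N K) U k) = iterM k (coeField U) :=
  coeField_iter_eq_iterM k h

/-- At the objects of record: `iterM k` is `C^∞` at `↑U` under the guard below `k`. [cite: Balaban1987RG1, (0.4) p.253, (0.21) p.256] -/
theorem contDiffAt_iterM_avOfRecord {K k : ℕ} {U : GaugeField (F.P K) 0 (SU N)} (h : SmallBelow (avOfRecord F N K) k U) :
    ContDiffAt ℝ ⊤ (iterM k : (PBond (F.P K) 0 → Matrix (Fin N) (Fin N) ℂ) → PBond (F.P K) k → Matrix (Fin N) (Fin N) ℂ) (coeField U) :=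
  contDiffAt_iterM k h

end Record

/-! ## §4  Composition with the exponential chart of 35a -/

section Chart

variable {P : Params} {j : ℕ} {N : ℕ}

/-- **`X ↦ ↑(U·exp X)` IS `C^∞`** (bond-wise: a constant times the entire `exp` of the inclusion `𝔰𝔲(N) ⊂ M_N(ℂ)`). [cite: Balaban1985RegularSpaces, (1.10) p.77 (bookkeeping)] -/
theorem contDiff_coeField_expChart (U : GaugeField P j (SU N)) :
    ContDiff ℝ ⊤ (fun X : PBond P j → lieSU (Fin N) => coeField (expChart U X)) := by
  refine contDiff_pi.2 fun b => ?_
  have hval : ContDiff ℝ ⊤ (fun X : PBond P j → lieSU (Fin N) => ((X b : lieSU (Fin N)) : Matrix (Fin N) (Fin N) ℂ)) :=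
    ((lieSU (Fin N)).subtypeL.contDiff).comp (contDiff_apply ℝ (lieSU (Fin N)) b)
  have hexp : ContDiff ℝ ⊤ (NormedSpace.exp : Matrix (Fin N) (Fin N) ℂ → Matrix (Fin N) (Fin N) ℂ) :=
    contDiff_iff_contDiffAt.2 fun X => ((NormedSpace.exp_analytic (𝕂 := ℂ) X).contDiffAt).restrict_scalars ℝ
  show ContDiff ℝ ⊤ fun X : PBond P j → lieSU (Fin N) => (U b : Matrix (Fin N) (Fin N) ℂ) * NormedSpace.exp ((X b : lieSU (Fin N)) : Matrix (Fin N) (Fin N) ℂ)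
  exact contDiff_const.mul (hexp.comp hval)

/-- The chart is centred: `coeField (expChart U 0) = coeField U`. [cite: Balaban1985RegularSpaces, (1.10) p.77 (bookkeeping)] -/
theorem coeField_expChart_zero (U : GaugeField P j (SU N)) : coeField (expChart U 0) = coeField U := by
  rw [expChart_zero]

variable [NeZero N]

/-- ★★ **`X ↦ iterM k ↑(U·exp X)` IS `C^∞` AT `0` UNDER THE GUARD BELOW `k`** — the differentiability half of 35a's `IsFibreChartNear` for the canonical chart of
the constraint `Ū^k = W_k` (the logarithm end is 35b-ii). [cite: Balaban1987RG1, (0.4) p.253 («analytic function»), (0.21) p.256; Balaban1985Variational, (3) p.278] -/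
theorem contDiffAt_iterM_expChart {U : GaugeField P 0 (SU N)} {k : ℕ} (h : SmallBelow (fun j => blockAvg (P := P) (j := j) expMeanLogSU) k U) :
    ContDiffAt ℝ ⊤ (fun X : PBond P 0 → lieSU (Fin N) => iterM k (coeField (expChart U X))) 0 := by
  have h1 : ContDiffAt ℝ ⊤ (iterM k : (PBond P 0 → Matrix (Fin N) (Fin N) ℂ) → PBond P k → Matrix (Fin N) (Fin N) ℂ)
      ((fun X : PBond P 0 → lieSU (Fin N) => coeField (expChart U X)) 0) := by
    show ContDiffAt ℝ ⊤ (iterM k) (coeField (expChart U 0))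
    rw [coeField_expChart_zero]
    exact contDiffAt_iterM k h
  exact h1.comp (0 : PBond P 0 → lieSU (Fin N)) (contDiff_coeField_expChart U).contDiffAt

end Chart

end Literature.MathematicalPhysics.QuantumFieldTheory.Balaban1983to89.Node00

end
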